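import Summits.QuantumFields.BalabanUV.InfraRed.StrongCouplingBallCertificate
import HarnessLib

/-!
# Strong-coupling front, rung F4 groundwork: the radial exponential moments of `SU(2)` bracketed on the EXTENDED
range `0 ≤ κ ≤ 8/5` — observatory of the non-perturbative crossover; no mass-gap claim

IR-3 v2 TWO-FRONT CROSSOVER LEDGER, front SC (`β₀`), SU(2), `d = 4`, Wilson normalisation `β_W = 4/g²`.
ABSOLUTE RULE of this package: No internally-minted statement may enter as a cited fact. Every hypothesis is either
kernel-proved in this package or a verbatim quotation of a PUBLISHED theorem with page reference. The manuscript(s)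
under audit are NOT citable for their own disputed steps — they are the thing under adjudication; programme-internal
(2001/route/tribunal) claims are never citable.

WHAT THIS FILE DOES.  The tree's ball certificate (`StrongCouplingBallSeries`, `StrongCouplingBallCertificate`,
`StrongCouplingCertArith`) brackets `Z = ∫ e^{κx₀} dσ`, `Z' = ∫ x₀ e^{κx₀} dσ` and the ball moments
`J(a,k) = ∫₀¹ r^a ∫ x₀^k e^{κ r x₀} dσ dr` on the Dobrushin range `0 ≤ κ ≤ 4/3` (`κ = 4‖B‖`, `‖B‖_op ≤ 1/3`, Wilson
`β_W ≤ 2/9`).  The forest-gauge what-if `4/15` of `StrongCouplingStaggerForest` needs the one-link quarter modulus up to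
`β_W < 4/15`, i.e. `‖B‖_op ≤ 2/5`, `κ ≤ 8/5`.  This module supplies the brackets on the extended range, with the SAME
engine (termwise Haar moments `m₀ … m₁₃`, Taylor tails `e^κ ≤ 5`):
* §1 `exp_le_five`, the `κ`-form brackets `sphere_bracket85` ∕ `ball_bracket85` (`partial(κ) ≤ J ≤ partial(κ) +
  5κ^N/N!`) and the evaluated brackets `sphere_eval85` ∕ `ball_eval85` (`partial(t) ≤ J ≤ partial(8/5) + 5(8/5)^N/N!`
  for `0 ≤ t ≤ κ ≤ 8/5`);
* §2 the two further Haar moments `m₁₂ = 33/1024`, `m₁₃ = 0`;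
* §3 NUMERICAL brackets on the piece `4/3 ≤ κ ≤ 8/5` (lower partial sums at `4/3`, upper at `8/5`):
  `1239/1000 ≤ Z ≤ 34/25`, `77/200 ≤ Z' ≤ 493/1000`, `289/1000 ≤ z_B ≤ 77/250`, `m₂ ≤ 211/1000`, `31/500 ≤ J41`,
  `J52 ≤ 641/10000`, `J72 ≤ 493/10000`, `J63 ≤ 31/1000`, `J74 ≤ 17/625`, non-negativity;
* §4 the SYMBOLIC brackets of `Z, Z', z_B` on `[0, 8/5]` and the cancellation brackets they imply:
  `0 ≤ 4Z' − κZ + κ³Z/20 ≤ κ³/50`, `0 ≤ κZ − 4Z' ≤ κ³/20`, `κ²/24 + κ⁴/400 ≤ Z − 4z_B`.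
The certificate on the piece and its consumers (flux inequality, one-link covariance for `‖B‖_op ≤ 2/5`, the quarter
modulus up to `β_W ≤ 4/15`) are the companion modules `StrongCouplingEightFifthsCertificate`,
`StrongCouplingQuarterModulusEightFifths`.

NOT CLAIMED: nothing here is a statement about measures on the lattice; no number of the ledger moves in this file
(owned strong-coupling number unchanged, `β_W < 2/9`); no mass-gap claim.
-/

noncomputable section

open MeasureTheory Filter Finset Real intervalIntegral
open scoped NNReal Quaternion Matrix BigOperators Topology Nat
open Matrix Complex
open Literature.MathematicalPhysics.QuantumLattice (su2Quat)
open Literature.MathematicalPhysics.QuantumFieldTheory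
open Literature.MathematicalPhysics.QuantumFieldTheory.Balaban1983to89.StrongCouplingVarianceWindow
  (integral_re_pow_odd)
open Summit.QuantumFields.BalabanUV.InfraRed.StrongCouplingHaarMoments (hasSum_integral_pow_mul_exp
  integral_re_pow_add_two)
open Summit.QuantumFields.BalabanUV.InfraRed.StrongCouplingBallSeries
open Summit.QuantumFields.BalabanUV.InfraRed.StrongCouplingBallCertificate (moment_table)

namespace Summit.QuantumFields.BalabanUV.InfraRed.StrongCouplingEightFifthsBrackets


/-! ## 1. Series brackets on `0 ≤ κ ≤ 8/5` -/

/-- `e^{4/5} ≤ 447/200` (Taylor with remainder, `Real.exp_bound'`). [folklore] -/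
theorem exp_four_fifths_le : Real.exp (4 / 5) ≤ 447 / 200 := by
  have h := Real.exp_bound' (x := 4 / 5) (by norm_num) (by norm_num) (n := 5) (by norm_num)
  have hs : ∑ m ∈ range 5, (4 / 5 : ℝ) ^ m / m.factorial = 4167 / 1875 := by
    simp only [sum_range_succ, sum_range_zero, Nat.factorial]
    norm_num
  rw [hs] at h
  norm_num [Nat.factorial] at h
  linarith

/-- **`e^κ ≤ 5` on the extended range `κ ≤ 8/5`** (`e^{8/5} = (e^{4/5})² ≤ (447/200)² < 5`). [folklore] -/
theorem exp_le_five {κ : ℝ} (hκ : κ ≤ 8 / 5) : Real.exp κ ≤ 5 := by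
  have h1 : Real.exp κ ≤ Real.exp (8 / 5) := Real.exp_le_exp.2 hκ
  have h2 : Real.exp (8 / 5) = Real.exp (4 / 5) * Real.exp (4 / 5) := by
    rw [← Real.exp_add]; norm_num
  have h3 := exp_four_fifths_le
  have h4 : 0 ≤ Real.exp (4 / 5) := (Real.exp_pos _).le
  nlinarith

/-- The upper bracket as a function of `κ ∈ [0, 8/5]`: `S ≤ Σ_{n<N} x_n κ^n + 5 κ^N / N!`. [folklore] -/
theorem le_partial_add_five_of_hasSum {x : ℕ → ℝ} {κ S : ℝ} (hκ : 0 ≤ κ) (hκ' : κ ≤ 8 / 5)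
    (hx : ∀ n, x n ≤ 1 / n !) (h : HasSum (fun n => x n * κ ^ n) S) (N : ℕ) :
    S ≤ ∑ n ∈ range N, x n * κ ^ n + 5 * κ ^ N / N ! := by
  have h1 := le_partial_add_of_hasSum hκ hx h N
  have h3 : κ ^ N * Real.exp κ / N ! ≤ 5 * κ ^ N / N ! := by
    have hN : (0 : ℝ) < N ! := by positivity
    rw [div_le_div_iff₀ hN hN]
    refine mul_le_mul_of_nonneg_right ?_ hN.le
    rw [mul_comm]
    exact mul_le_mul_of_nonneg_right (exp_le_five hκ') (pow_nonneg hκ N)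
  linarith

/-- Monotonicity of the evaluated bracket: `Σ_{n<N} x_n κ^n + 5κ^N/N! ≤ Σ_{n<N} x_n K^n + 5K^N/N!` for
`0 ≤ κ ≤ K`, `x_n ≥ 0`. [folklore] -/
theorem partial_add_five_mono {x : ℕ → ℝ} {κ K : ℝ} (hκ : 0 ≤ κ) (hκK : κ ≤ K) (hx0 : ∀ n, 0 ≤ x n) (N : ℕ) :
    ∑ n ∈ range N, x n * κ ^ n + 5 * κ ^ N / N ! ≤ ∑ n ∈ range N, x n * K ^ n + 5 * K ^ N / N ! := by
  have h2 : ∑ n ∈ range N, x n * κ ^ n ≤ ∑ n ∈ range N, x n * K ^ n :=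
    sum_le_sum fun n _ => mul_le_mul_of_nonneg_left (pow_le_pow_left₀ hκ hκK n) (hx0 n)
  have h3 : 5 * κ ^ N / N ! ≤ 5 * K ^ N / N ! :=
    div_le_div_of_nonneg_right (mul_le_mul_of_nonneg_left (pow_le_pow_left₀ hκ hκK N) (by norm_num))
      (by positivity)
  linarith

/-- Partial sums with non-negative coefficients are monotone in the variable. [folklore] -/
theorem partial_mono {x : ℕ → ℝ} {t κ : ℝ} (ht : 0 ≤ t) (htκ : t ≤ κ) (hx0 : ∀ n, 0 ≤ x n) (N : ℕ) :
    ∑ n ∈ range N, x n * t ^ n ≤ ∑ n ∈ range N, x n * κ ^ n :=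
  sum_le_sum fun n _ => mul_le_mul_of_nonneg_left (pow_le_pow_left₀ ht htκ n) (hx0 n)

/-- **Two-sided bracket of an exponential (sphere) moment** on `0 ≤ κ ≤ 8/5`:
`Σ_{n<N} κ^n/n! m_{k+n} ≤ ∫ x₀^k e^{κ x₀} dσ ≤ (same sum) + 5 κ^N/N!`. [folklore] -/
theorem sphere_bracket85 (k : ℕ) {κ : ℝ} (hκ : 0 ≤ κ) (hκ' : κ ≤ 8 / 5) (N : ℕ) :
    ∑ n ∈ range N, κ ^ n / n ! * ∫ g : Matrix.specialUnitaryGroup (Fin 2) ℂ, (su2Quat g).re ^ (k + n) ∂(haarProbability (Matrix.specialUnitaryGroup (Fin 2) ℂ))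
      ≤ ∫ g : Matrix.specialUnitaryGroup (Fin 2) ℂ, (su2Quat g).re ^ k * Real.exp (κ * (su2Quat g).re) ∂(haarProbability (Matrix.specialUnitaryGroup (Fin 2) ℂ)) ∧
    ∫ g : Matrix.specialUnitaryGroup (Fin 2) ℂ, (su2Quat g).re ^ k * Real.exp (κ * (su2Quat g).re) ∂(haarProbability (Matrix.specialUnitaryGroup (Fin 2) ℂ))
      ≤ ∑ n ∈ range N, κ ^ n / n ! * ∫ g : Matrix.specialUnitaryGroup (Fin 2) ℂ, (su2Quat g).re ^ (k + n) ∂(haarProbability (Matrix.specialUnitaryGroup (Fin 2) ℂ)) + 5 * κ ^ N / N ! := by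
  have h := hasSum_integral_pow_mul_exp k κ
  have h' : HasSum (fun n : ℕ => (1 / (n ! * 1) * ∫ g : Matrix.specialUnitaryGroup (Fin 2) ℂ, (su2Quat g).re ^ (k + n) ∂(haarProbability (Matrix.specialUnitaryGroup (Fin 2) ℂ))) * κ ^ n)
      (∫ g : Matrix.specialUnitaryGroup (Fin 2) ℂ, (su2Quat g).re ^ k * Real.exp (κ * (su2Quat g).re) ∂(haarProbability (Matrix.specialUnitaryGroup (Fin 2) ℂ))) := by
    convert h using 1; funext n; ring
  have hlo := partial_le_of_hasSum hκ (fun n => (coeff_mem k n le_rfl).1) h' N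
  have hhi := le_partial_add_five_of_hasSum hκ hκ' (fun n => (coeff_mem k n le_rfl).2) h' N
  have e : ∑ n ∈ range N, (1 / (n ! * 1) * ∫ g : Matrix.specialUnitaryGroup (Fin 2) ℂ, (su2Quat g).re ^ (k + n) ∂(haarProbability (Matrix.specialUnitaryGroup (Fin 2) ℂ))) * κ ^ n =
      ∑ n ∈ range N, κ ^ n / n ! * ∫ g : Matrix.specialUnitaryGroup (Fin 2) ℂ, (su2Quat g).re ^ (k + n) ∂(haarProbability (Matrix.specialUnitaryGroup (Fin 2) ℂ)) := sum_congr rfl fun n _ => by ring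
  rw [e] at hlo hhi
  exact ⟨hlo, hhi⟩

/-- **Evaluated sphere bracket**: for `0 ≤ t ≤ κ ≤ 8/5`,
`Σ_{n<N} t^n/n! m_{k+n} ≤ ∫ x₀^k e^{κ x₀} dσ ≤ Σ_{n<N} (8/5)^n/n! m_{k+n} + 5 (8/5)^N/N!`. [folklore] -/
theorem sphere_eval85 (k : ℕ) {t κ : ℝ} (ht : 0 ≤ t) (htκ : t ≤ κ) (hκ' : κ ≤ 8 / 5) (N : ℕ) :
    ∑ n ∈ range N, t ^ n / n ! * ∫ g : Matrix.specialUnitaryGroup (Fin 2) ℂ, (su2Quat g).re ^ (k + n) ∂(haarProbability (Matrix.specialUnitaryGroup (Fin 2) ℂ))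
      ≤ ∫ g : Matrix.specialUnitaryGroup (Fin 2) ℂ, (su2Quat g).re ^ k * Real.exp (κ * (su2Quat g).re) ∂(haarProbability (Matrix.specialUnitaryGroup (Fin 2) ℂ)) ∧
    ∫ g : Matrix.specialUnitaryGroup (Fin 2) ℂ, (su2Quat g).re ^ k * Real.exp (κ * (su2Quat g).re) ∂(haarProbability (Matrix.specialUnitaryGroup (Fin 2) ℂ))
      ≤ ∑ n ∈ range N, (8 / 5 : ℝ) ^ n / n ! * ∫ g : Matrix.specialUnitaryGroup (Fin 2) ℂ, (su2Quat g).re ^ (k + n) ∂(haarProbability (Matrix.specialUnitaryGroup (Fin 2) ℂ)) + 5 * (8 / 5) ^ N / N ! := by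
  have hκ : 0 ≤ κ := ht.trans htκ
  obtain ⟨hlo, hhi⟩ := sphere_bracket85 k hκ hκ' N
  have hx0 : ∀ n : ℕ, 0 ≤ 1 / (n ! * 1) * ∫ g : Matrix.specialUnitaryGroup (Fin 2) ℂ, (su2Quat g).re ^ (k + n) ∂(haarProbability (Matrix.specialUnitaryGroup (Fin 2) ℂ)) :=
    fun n => (coeff_mem k n le_rfl).1
  have h1 := partial_mono ht htκ hx0 N
  have h2 := partial_add_five_mono hκ hκ' hx0 N
  have e : ∀ s : ℝ, ∑ n ∈ range N, (1 / (n ! * 1) * ∫ g : Matrix.specialUnitaryGroup (Fin 2) ℂ, (su2Quat g).re ^ (k + n) ∂(haarProbability (Matrix.specialUnitaryGroup (Fin 2) ℂ))) * s ^ n =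
      ∑ n ∈ range N, s ^ n / n ! * ∫ g : Matrix.specialUnitaryGroup (Fin 2) ℂ, (su2Quat g).re ^ (k + n) ∂(haarProbability (Matrix.specialUnitaryGroup (Fin 2) ℂ)) :=
    fun s => sum_congr rfl fun n _ => by ring
  rw [e, e] at h1 h2
  exact ⟨h1.trans hlo, hhi.trans h2⟩

/-- **Two-sided bracket of a ball moment** on `0 ≤ κ ≤ 8/5`:
`Σ_{n<N} κ^n/(n!(n+a+1)) m_{k+n} ≤ ∫₀¹ r^a ∫ x₀^k e^{κ r x₀} dσ dr ≤ (same sum) + 5 κ^N/N!`. [folklore] -/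
theorem ball_bracket85 (k a : ℕ) {κ : ℝ} (hκ : 0 ≤ κ) (hκ' : κ ≤ 8 / 5) (N : ℕ) :
    ∑ n ∈ range N, κ ^ n / (n ! * (n + a + 1)) * ∫ g : Matrix.specialUnitaryGroup (Fin 2) ℂ, (su2Quat g).re ^ (k + n) ∂(haarProbability (Matrix.specialUnitaryGroup (Fin 2) ℂ))
      ≤ ∫ r in (0:ℝ)..1, r ^ a * ∫ g : Matrix.specialUnitaryGroup (Fin 2) ℂ, (su2Quat g).re ^ k * Real.exp (κ * r * (su2Quat g).re) ∂(haarProbability (Matrix.specialUnitaryGroup (Fin 2) ℂ)) ∧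
    ∫ r in (0:ℝ)..1, r ^ a * ∫ g : Matrix.specialUnitaryGroup (Fin 2) ℂ, (su2Quat g).re ^ k * Real.exp (κ * r * (su2Quat g).re) ∂(haarProbability (Matrix.specialUnitaryGroup (Fin 2) ℂ))
      ≤ ∑ n ∈ range N, κ ^ n / (n ! * (n + a + 1)) * ∫ g : Matrix.specialUnitaryGroup (Fin 2) ℂ, (su2Quat g).re ^ (k + n) ∂(haarProbability (Matrix.specialUnitaryGroup (Fin 2) ℂ))
        + 5 * κ ^ N / N ! := by
  have h := hasSum_ball k a κ
  have h' : HasSum (fun n : ℕ => (1 / (n ! * (n + a + 1)) * ∫ g : Matrix.specialUnitaryGroup (Fin 2) ℂ, (su2Quat g).re ^ (k + n) ∂(haarProbability (Matrix.specialUnitaryGroup (Fin 2) ℂ))) * κ ^ n)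
      (∫ r in (0:ℝ)..1, r ^ a * ∫ g : Matrix.specialUnitaryGroup (Fin 2) ℂ, (su2Quat g).re ^ k * Real.exp (κ * r * (su2Quat g).re) ∂(haarProbability (Matrix.specialUnitaryGroup (Fin 2) ℂ))) := by
    convert h using 1; funext n; ring
  have hw : ∀ n : ℕ, (1 : ℝ) ≤ n + a + 1 := fun n => by
    linarith [(Nat.cast_nonneg n : (0:ℝ) ≤ n), (Nat.cast_nonneg a : (0:ℝ) ≤ a)]
  have hlo := partial_le_of_hasSum hκ (fun n => (coeff_mem k n (hw n)).1) h' N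
  have hhi := le_partial_add_five_of_hasSum hκ hκ' (fun n => (coeff_mem k n (hw n)).2) h' N
  have e : ∑ n ∈ range N, (1 / (n ! * (n + a + 1)) * ∫ g : Matrix.specialUnitaryGroup (Fin 2) ℂ, (su2Quat g).re ^ (k + n) ∂(haarProbability (Matrix.specialUnitaryGroup (Fin 2) ℂ))) * κ ^ n =
      ∑ n ∈ range N, κ ^ n / (n ! * (n + a + 1)) * ∫ g : Matrix.specialUnitaryGroup (Fin 2) ℂ, (su2Quat g).re ^ (k + n) ∂(haarProbability (Matrix.specialUnitaryGroup (Fin 2) ℂ)) :=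
    sum_congr rfl fun n _ => by ring
  rw [e] at hlo hhi
  exact ⟨hlo, hhi⟩

/-- **Evaluated ball bracket**: for `0 ≤ t ≤ κ ≤ 8/5`,
`Σ_{n<N} t^n/(n!(n+a+1)) m_{k+n} ≤ ∫₀¹ r^a ∫ x₀^k e^{κ r x₀} dσ dr ≤ Σ_{n<N} (8/5)^n/(n!(n+a+1)) m_{k+n} + 5(8/5)^N/N!`.
[folklore] -/
theorem ball_eval85 (k a : ℕ) {t κ : ℝ} (ht : 0 ≤ t) (htκ : t ≤ κ) (hκ' : κ ≤ 8 / 5) (N : ℕ) :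
    ∑ n ∈ range N, t ^ n / (n ! * (n + a + 1)) * ∫ g : Matrix.specialUnitaryGroup (Fin 2) ℂ, (su2Quat g).re ^ (k + n) ∂(haarProbability (Matrix.specialUnitaryGroup (Fin 2) ℂ))
      ≤ ∫ r in (0:ℝ)..1, r ^ a * ∫ g : Matrix.specialUnitaryGroup (Fin 2) ℂ, (su2Quat g).re ^ k * Real.exp (κ * r * (su2Quat g).re) ∂(haarProbability (Matrix.specialUnitaryGroup (Fin 2) ℂ)) ∧
    ∫ r in (0:ℝ)..1, r ^ a * ∫ g : Matrix.specialUnitaryGroup (Fin 2) ℂ, (su2Quat g).re ^ k * Real.exp (κ * r * (su2Quat g).re) ∂(haarProbability (Matrix.specialUnitaryGroup (Fin 2) ℂ))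
      ≤ ∑ n ∈ range N, (8 / 5 : ℝ) ^ n / (n ! * (n + a + 1)) * ∫ g : Matrix.specialUnitaryGroup (Fin 2) ℂ, (su2Quat g).re ^ (k + n) ∂(haarProbability (Matrix.specialUnitaryGroup (Fin 2) ℂ))
        + 5 * (8 / 5) ^ N / N ! := by
  have hκ : 0 ≤ κ := ht.trans htκ
  obtain ⟨hlo, hhi⟩ := ball_bracket85 k a hκ hκ' N
  have hw : ∀ n : ℕ, (1 : ℝ) ≤ n + a + 1 := fun n => by
    linarith [(Nat.cast_nonneg n : (0:ℝ) ≤ n), (Nat.cast_nonneg a : (0:ℝ) ≤ a)]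
  have hx0 : ∀ n : ℕ, 0 ≤ 1 / (n ! * (n + a + 1)) * ∫ g : Matrix.specialUnitaryGroup (Fin 2) ℂ, (su2Quat g).re ^ (k + n) ∂(haarProbability (Matrix.specialUnitaryGroup (Fin 2) ℂ)) :=
    fun n => (coeff_mem k n (hw n)).1
  have h1 := partial_mono ht htκ hx0 N
  have h2 := partial_add_five_mono hκ hκ' hx0 N
  have e : ∀ s : ℝ, ∑ n ∈ range N, (1 / (n ! * (n + a + 1)) * ∫ g : Matrix.specialUnitaryGroup (Fin 2) ℂ, (su2Quat g).re ^ (k + n) ∂(haarProbability (Matrix.specialUnitaryGroup (Fin 2) ℂ))) * s ^ n =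
      ∑ n ∈ range N, s ^ n / (n ! * (n + a + 1)) * ∫ g : Matrix.specialUnitaryGroup (Fin 2) ℂ, (su2Quat g).re ^ (k + n) ∂(haarProbability (Matrix.specialUnitaryGroup (Fin 2) ℂ)) :=
    fun s => sum_congr rfl fun n _ => by ring
  rw [e, e] at h1 h2
  exact ⟨h1.trans hlo, hhi.trans h2⟩

/-- Every ball moment is non-negative on `0 ≤ κ ≤ 8/5` (empty partial sum). [folklore] -/
theorem ball_nonneg85 (k a : ℕ) {κ : ℝ} (hκ : 0 ≤ κ) (hκ' : κ ≤ 8 / 5) :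
    0 ≤ ∫ r in (0:ℝ)..1, r ^ a * ∫ g : Matrix.specialUnitaryGroup (Fin 2) ℂ, (su2Quat g).re ^ k * Real.exp (κ * r * (su2Quat g).re) ∂(haarProbability (Matrix.specialUnitaryGroup (Fin 2) ℂ)) := by
  simpa using (ball_bracket85 k a hκ hκ' 0).1

/-! ## 2. Two more Haar moments -/

/-- `∫ x₀¹² dσ = 33/1024`. [folklore] -/
theorem moment_twelve : ∫ g : Matrix.specialUnitaryGroup (Fin 2) ℂ, (su2Quat g).re ^ 12 ∂(haarProbability (Matrix.specialUnitaryGroup (Fin 2) ℂ)) = 33 / 1024 := by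
  have h := integral_re_pow_add_two 10
  obtain ⟨-, -, -, -, -, -, -, -, -, -, m10, -⟩ := moment_table
  norm_num at h
  rw [m10] at h
  rw [h]; norm_num

/-- `∫ x₀¹³ dσ = 0`. [folklore] -/
theorem moment_thirteen : ∫ g : Matrix.specialUnitaryGroup (Fin 2) ℂ, (su2Quat g).re ^ 13 ∂(haarProbability (Matrix.specialUnitaryGroup (Fin 2) ℂ)) = 0 := by
  simpa using integral_re_pow_odd 6


/-! ## 3. Numerical brackets on the piece `4/3 ≤ κ ≤ 8/5` -/

/-- **The twelve numerical brackets on the piece `4/3 ≤ κ ≤ 8/5`** (lower partial sums evaluated at `4/3`, upper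
ones at `8/5`, `N = 10`, Haar moments `m₀ … m₁₃`): `1239/1000 ≤ Z ≤ 34/25`, `77/200 ≤ Z' ≤ 493/1000`,
`289/1000 ≤ z_B ≤ 77/250`, `m₂ ≤ 211/1000`, `31/500 ≤ J41`, `J52 ≤ 641/10000`, `J72 ≤ 493/10000`, `J63 ≤ 31/1000`,
`J74 ≤ 17/625`. [folklore] -/
theorem piece_brackets {κ : ℝ} (hκ : 4 / 3 ≤ κ) (hκ' : κ ≤ 8 / 5) :
    1239 / 1000 ≤ ∫ g : Matrix.specialUnitaryGroup (Fin 2) ℂ, Real.exp (κ * (su2Quat g).re) ∂(haarProbability (Matrix.specialUnitaryGroup (Fin 2) ℂ)) ∧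
    ∫ g : Matrix.specialUnitaryGroup (Fin 2) ℂ, Real.exp (κ * (su2Quat g).re) ∂(haarProbability (Matrix.specialUnitaryGroup (Fin 2) ℂ)) ≤ 34 / 25 ∧
    77 / 200 ≤ ∫ g : Matrix.specialUnitaryGroup (Fin 2) ℂ, (su2Quat g).re * Real.exp (κ * (su2Quat g).re) ∂(haarProbability (Matrix.specialUnitaryGroup (Fin 2) ℂ)) ∧
    ∫ g : Matrix.specialUnitaryGroup (Fin 2) ℂ, (su2Quat g).re * Real.exp (κ * (su2Quat g).re) ∂(haarProbability (Matrix.specialUnitaryGroup (Fin 2) ℂ)) ≤ 493 / 1000 ∧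
    289 / 1000 ≤ ∫ r in (0:ℝ)..1, r ^ 3 * ∫ g : Matrix.specialUnitaryGroup (Fin 2) ℂ, Real.exp (κ * r * (su2Quat g).re) ∂(haarProbability (Matrix.specialUnitaryGroup (Fin 2) ℂ)) ∧
    ∫ r in (0:ℝ)..1, r ^ 3 * ∫ g : Matrix.specialUnitaryGroup (Fin 2) ℂ, Real.exp (κ * r * (su2Quat g).re) ∂(haarProbability (Matrix.specialUnitaryGroup (Fin 2) ℂ)) ≤ 77 / 250 ∧
    ∫ r in (0:ℝ)..1, r ^ 5 * ∫ g : Matrix.specialUnitaryGroup (Fin 2) ℂ, Real.exp (κ * r * (su2Quat g).re) ∂(haarProbability (Matrix.specialUnitaryGroup (Fin 2) ℂ)) ≤ 211 / 1000 ∧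
    31 / 500 ≤ ∫ r in (0:ℝ)..1, r ^ 4 * ∫ g : Matrix.specialUnitaryGroup (Fin 2) ℂ, (su2Quat g).re * Real.exp (κ * r * (su2Quat g).re) ∂(haarProbability (Matrix.specialUnitaryGroup (Fin 2) ℂ)) ∧
    ∫ r in (0:ℝ)..1, r ^ 5 * ∫ g : Matrix.specialUnitaryGroup (Fin 2) ℂ, (su2Quat g).re ^ 2 * Real.exp (κ * r * (su2Quat g).re) ∂(haarProbability (Matrix.specialUnitaryGroup (Fin 2) ℂ)) ≤ 641 / 10000 ∧
    ∫ r in (0:ℝ)..1, r ^ 7 * ∫ g : Matrix.specialUnitaryGroup (Fin 2) ℂ, (su2Quat g).re ^ 2 * Real.exp (κ * r * (su2Quat g).re) ∂(haarProbability (Matrix.specialUnitaryGroup (Fin 2) ℂ)) ≤ 493 / 10000 ∧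
    ∫ r in (0:ℝ)..1, r ^ 6 * ∫ g : Matrix.specialUnitaryGroup (Fin 2) ℂ, (su2Quat g).re ^ 3 * Real.exp (κ * r * (su2Quat g).re) ∂(haarProbability (Matrix.specialUnitaryGroup (Fin 2) ℂ)) ≤ 31 / 1000 ∧
    ∫ r in (0:ℝ)..1, r ^ 7 * ∫ g : Matrix.specialUnitaryGroup (Fin 2) ℂ, (su2Quat g).re ^ 4 * Real.exp (κ * r * (su2Quat g).re) ∂(haarProbability (Matrix.specialUnitaryGroup (Fin 2) ℂ)) ≤ 17 / 625 := by
  have h43 : (0:ℝ) ≤ 4 / 3 := by norm_num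
  have hZ := sphere_eval85 0 h43 hκ hκ' 10
  have hZp := sphere_eval85 1 h43 hκ hκ' 10
  have hzB := ball_eval85 0 3 h43 hκ hκ' 10
  have hm2 := (ball_eval85 0 5 h43 hκ hκ' 10).2
  have hJ41 := (ball_eval85 1 4 h43 hκ hκ' 10).1
  have hJ52 := (ball_eval85 2 5 h43 hκ hκ' 10).2
  have hJ72 := (ball_eval85 2 7 h43 hκ hκ' 10).2
  have hJ63 := (ball_eval85 3 6 h43 hκ hκ' 10).2
  have hJ74 := (ball_eval85 4 7 h43 hκ hκ' 10).2
  obtain ⟨m0, m1, m2, m3, m4, m5, m6, m7, m8, m9, m10, m11⟩ := moment_table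
  simp only [sum_range_succ, sum_range_zero, Nat.reduceAdd, m0, m1, m2, m3, m4, m5, m6, m7, m8, m9, m10, m11,
    moment_twelve, moment_thirteen, Nat.factorial, Nat.succ_eq_add_one, Nat.reduceMul, Nat.cast_ofNat,
    Nat.cast_one] at hZ hZp hzB hm2 hJ41 hJ52 hJ72 hJ63 hJ74
  simp only [pow_zero, one_mul] at hZ hzB hm2
  simp only [pow_one] at hZp hJ41
  norm_num at hZ hZp hzB hm2 hJ41 hJ52 hJ72 hJ63 hJ74
  exact ⟨by linarith [hZ.1], by linarith [hZ.2], by linarith [hZp.1], by linarith [hZp.2], by linarith [hzB.1],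
    by linarith [hzB.2], by linarith, by linarith, by linarith, by linarith, by linarith, by linarith⟩

/-! ## 4. Symbolic brackets on `0 ≤ κ ≤ 8/5` and the cancellation brackets -/

/-- `Z` is bracketed by its degree-`8` Taylor polynomial, `0 ≤ κ ≤ 8/5` (tail `5κ¹⁰/10!`). [folklore] -/
theorem Z_bracket85 {κ : ℝ} (hκ : 0 ≤ κ) (hκ' : κ ≤ 8 / 5) :
    1 + κ ^ 2 / 8 + κ ^ 4 / 192 + κ ^ 6 / 9216 + κ ^ 8 / 737280
      ≤ ∫ g : Matrix.specialUnitaryGroup (Fin 2) ℂ, Real.exp (κ * (su2Quat g).re) ∂(haarProbability (Matrix.specialUnitaryGroup (Fin 2) ℂ)) ∧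
    ∫ g : Matrix.specialUnitaryGroup (Fin 2) ℂ, Real.exp (κ * (su2Quat g).re) ∂(haarProbability (Matrix.specialUnitaryGroup (Fin 2) ℂ))
      ≤ 1 + κ ^ 2 / 8 + κ ^ 4 / 192 + κ ^ 6 / 9216 + κ ^ 8 / 737280 + 5 * κ ^ 10 / 3628800 := by
  have h := sphere_bracket85 0 hκ hκ' 10
  obtain ⟨m0, m1, m2, m3, m4, m5, m6, m7, m8, m9, -, -⟩ := moment_table
  simp only [sum_range_succ, sum_range_zero, Nat.reduceAdd, m0, m1, m2, m3, m4, m5, m6, m7, m8, m9,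
    Nat.factorial, Nat.succ_eq_add_one, Nat.reduceMul, Nat.cast_ofNat, Nat.cast_one] at h
  simp only [pow_zero, one_mul] at h
  norm_num at h
  constructor <;> linarith [h.1, h.2]

/-- `Z'` is bracketed by its degree-`9` Taylor polynomial, `0 ≤ κ ≤ 8/5`. [folklore] -/
theorem Zp_bracket85 {κ : ℝ} (hκ : 0 ≤ κ) (hκ' : κ ≤ 8 / 5) :
    κ / 4 + κ ^ 3 / 48 + κ ^ 5 / 1536 + κ ^ 7 / 92160 + κ ^ 9 / 8847360
      ≤ ∫ g : Matrix.specialUnitaryGroup (Fin 2) ℂ, (su2Quat g).re * Real.exp (κ * (su2Quat g).re) ∂(haarProbability (Matrix.specialUnitaryGroup (Fin 2) ℂ)) ∧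
    ∫ g : Matrix.specialUnitaryGroup (Fin 2) ℂ, (su2Quat g).re * Real.exp (κ * (su2Quat g).re) ∂(haarProbability (Matrix.specialUnitaryGroup (Fin 2) ℂ))
      ≤ κ / 4 + κ ^ 3 / 48 + κ ^ 5 / 1536 + κ ^ 7 / 92160 + κ ^ 9 / 8847360 + 5 * κ ^ 10 / 3628800 := by
  have h := sphere_bracket85 1 hκ hκ' 10
  obtain ⟨-, m1, m2, m3, m4, m5, m6, m7, m8, m9, m10, -⟩ := moment_table
  simp only [sum_range_succ, sum_range_zero, Nat.reduceAdd, m1, m2, m3, m4, m5, m6, m7, m8, m9, m10,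
    Nat.factorial, Nat.succ_eq_add_one, Nat.reduceMul, Nat.cast_ofNat, Nat.cast_one] at h
  simp only [pow_one] at h
  norm_num at h
  constructor <;> linarith [h.1, h.2]

/-- `z_B` is bracketed by its degree-`8` polynomial, `0 ≤ κ ≤ 8/5`. [folklore] -/
theorem zB_bracket85 {κ : ℝ} (hκ : 0 ≤ κ) (hκ' : κ ≤ 8 / 5) :
    1 / 4 + κ ^ 2 / 48 + κ ^ 4 / 1536 + κ ^ 6 / 92160 + κ ^ 8 / 8847360
      ≤ ∫ r in (0:ℝ)..1, r ^ 3 * ∫ g : Matrix.specialUnitaryGroup (Fin 2) ℂ, Real.exp (κ * r * (su2Quat g).re) ∂(haarProbability (Matrix.specialUnitaryGroup (Fin 2) ℂ)) ∧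
    ∫ r in (0:ℝ)..1, r ^ 3 * ∫ g : Matrix.specialUnitaryGroup (Fin 2) ℂ, Real.exp (κ * r * (su2Quat g).re) ∂(haarProbability (Matrix.specialUnitaryGroup (Fin 2) ℂ))
      ≤ 1 / 4 + κ ^ 2 / 48 + κ ^ 4 / 1536 + κ ^ 6 / 92160 + κ ^ 8 / 8847360 + 5 * κ ^ 10 / 3628800 := by
  have h := ball_bracket85 0 3 hκ hκ' 10
  obtain ⟨m0, m1, m2, m3, m4, m5, m6, m7, m8, m9, -, -⟩ := moment_table
  simp only [sum_range_succ, sum_range_zero, Nat.reduceAdd, m0, m1, m2, m3, m4, m5, m6, m7, m8, m9,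
    Nat.factorial, Nat.succ_eq_add_one, Nat.reduceMul, Nat.cast_ofNat, Nat.cast_one] at h
  simp only [pow_zero, one_mul] at h
  norm_num at h
  constructor <;> linarith [h.1, h.2]

/-- `κ^(j+i) ≤ (8/5)^j κ^i` on `0 ≤ κ ≤ 8/5`. [folklore] -/
theorem pow_le_mul85 {κ : ℝ} (hκ : 0 ≤ κ) (hκ' : κ ≤ 8 / 5) (j i : ℕ) :
    κ ^ (j + i) ≤ (8 / 5 : ℝ) ^ j * κ ^ i := by
  rw [pow_add]
  exact mul_le_mul_of_nonneg_right (pow_le_pow_left₀ hκ hκ' j) (pow_nonneg hκ i)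

/-- **Polynomial bookkeeping on the extended range.**  From the three symbolic brackets: `1 ≤ Z`, `1/4 ≤ z_B` and the
three CANCELLATION brackets `0 ≤ 4Z' − κZ + κ³Z/20 ≤ κ³/50`, `0 ≤ κZ − 4Z' ≤ κ³/20`, `κ²/24 + κ⁴/400 ≤ Z − 4 z_B`
(`0 ≤ κ ≤ 8/5`). [folklore] -/
theorem cancel_brackets85 {κ Z Zp zB : ℝ} (hκ : 0 ≤ κ) (hκ' : κ ≤ 8 / 5)
    (hZl : 1 + κ ^ 2 / 8 + κ ^ 4 / 192 + κ ^ 6 / 9216 + κ ^ 8 / 737280 ≤ Z)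
    (hZu : Z ≤ 1 + κ ^ 2 / 8 + κ ^ 4 / 192 + κ ^ 6 / 9216 + κ ^ 8 / 737280 + 5 * κ ^ 10 / 3628800)
    (hZpl : κ / 4 + κ ^ 3 / 48 + κ ^ 5 / 1536 + κ ^ 7 / 92160 + κ ^ 9 / 8847360 ≤ Zp)
    (hZpu : Zp ≤ κ / 4 + κ ^ 3 / 48 + κ ^ 5 / 1536 + κ ^ 7 / 92160 + κ ^ 9 / 8847360 + 5 * κ ^ 10 / 3628800)
    (hBl : 1 / 4 + κ ^ 2 / 48 + κ ^ 4 / 1536 + κ ^ 6 / 92160 + κ ^ 8 / 8847360 ≤ zB)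
    (hBu : zB ≤ 1 / 4 + κ ^ 2 / 48 + κ ^ 4 / 1536 + κ ^ 6 / 92160 + κ ^ 8 / 8847360 + 5 * κ ^ 10 / 3628800) :
    1 ≤ Z ∧ 1 / 4 ≤ zB ∧
    0 ≤ 4 * Zp - κ * Z + κ ^ 3 * Z / 20 ∧ 4 * Zp - κ * Z + κ ^ 3 * Z / 20 ≤ 1 / 50 * κ ^ 3 ∧
    0 ≤ κ * Z - 4 * Zp ∧ κ * Z - 4 * Zp ≤ 1 / 20 * κ ^ 3 ∧ κ ^ 2 / 24 + κ ^ 4 / 400 ≤ Z - 4 * zB := by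
  -- monomial bounds on `[0, 8/5]`
  have k5 := pow_le_mul85 hκ hκ' 2 3
  have k7 := pow_le_mul85 hκ hκ' 4 3
  have k9 := pow_le_mul85 hκ hκ' 6 3
  have k10 := pow_le_mul85 hκ hκ' 7 3
  have k11 := pow_le_mul85 hκ hκ' 8 3
  have k13 := pow_le_mul85 hκ hκ' 10 3
  have q10 := pow_le_mul85 hκ hκ' 6 4
  norm_num at k5 k7 k9 k10 k11 k13 q10
  obtain ⟨p2, p3, p4, p5, p6, p7⟩ : 0 ≤ κ ^ 2 ∧ 0 ≤ κ ^ 3 ∧ 0 ≤ κ ^ 4 ∧ 0 ≤ κ ^ 5 ∧ 0 ≤ κ ^ 6 ∧ 0 ≤ κ ^ 7 :=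
    ⟨by positivity, by positivity, by positivity, by positivity, by positivity, by positivity⟩
  obtain ⟨p8, p9, p10, p11, p13⟩ : 0 ≤ κ ^ 8 ∧ 0 ≤ κ ^ 9 ∧ 0 ≤ κ ^ 10 ∧ 0 ≤ κ ^ 11 ∧ 0 ≤ κ ^ 13 :=
    ⟨by positivity, by positivity, by positivity, by positivity, by positivity⟩
  -- the products `κ · Z`, `κ³ · Z` against the brackets of `Z`, expanded into monomials
  have e3 : κ * Z ≤ κ + κ ^ 3 / 8 + κ ^ 5 / 192 + κ ^ 7 / 9216 + κ ^ 9 / 737280 + 5 * κ ^ 11 / 3628800 := by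
    linear_combination mul_le_mul_of_nonneg_left hZu hκ
  have e4 : κ + κ ^ 3 / 8 + κ ^ 5 / 192 + κ ^ 7 / 9216 + κ ^ 9 / 737280 ≤ κ * Z := by
    linear_combination mul_le_mul_of_nonneg_left hZl hκ
  have e5 : κ ^ 3 + κ ^ 5 / 8 + κ ^ 7 / 192 + κ ^ 9 / 9216 + κ ^ 11 / 737280 ≤ κ ^ 3 * Z := by
    linear_combination mul_le_mul_of_nonneg_left hZl p3
  have e6 : κ ^ 3 * Z ≤ κ ^ 3 + κ ^ 5 / 8 + κ ^ 7 / 192 + κ ^ 9 / 9216 + κ ^ 11 / 737280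
      + 5 * κ ^ 13 / 3628800 := by
    linear_combination mul_le_mul_of_nonneg_left hZu p3
  exact ⟨by linarith, by linarith, by linarith, by linarith, by linarith, by linarith, by linarith⟩

end Summit.QuantumFields.BalabanUV.InfraRed.StrongCouplingEightFifthsBrackets
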